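import Literature.NumberTheory.Rogawski1990.ObsHasseOfStepsSemisimple
import Literature.NumberTheory.Rogawski1990.SingularObstructionVanishing
import Literature.NumberTheory.Rogawski1990.AdelicCartanClassPlacewise
import Literature.NumberTheory.Rogawski1990.CartanIndex
import Literature.NumberTheory.Rogawski1990.SingularLocalConjugacy
import Literature.NumberTheory.Rogawski1990.BlockDetFrame
import Literature.NumberTheory.Rogawski1990.SingularLocalConjugacySplit
import Literature.NumberTheory.Automorphic.QuadraticLocalBaseChange
import Literature.NumberTheory.Rogawski1990.MatchingAdeleGKConjSemisimple
import Literature.NumberTheory.Rogawski1990.AnisotropicUnitarySemisimple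
import HarnessLib

/-!
# Towards the singular ObsHasse (ED. 1): the idempotent∕frame bridge for `blockDet`, and the FINITE NON-SPLIT clause of the placewise socket
# `hreal` at `obs := singularObs` (Rogawski 1990, §3.3 Prop. 3.3.1 p. 22, §3.8 Prop. 3.8.1 pp. 27–30; Kottwitz 1986 §7, §9)

Topic `NumberTheory/Rogawski1990`; namespace `Literature.NumberTheory.Rogawski1990`; **THEOREMS ONLY** (no definition, no named fact, no instance, no
notation, no `sorry`).  Cell `pub/hodgecm-mathlib`, ENGINE T1 (crux H413 = `stmt-HodgeConjecture-24833`), row O7 «singular semisimple classes»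
(CENSUS-O7 v3 §3, RULING #107 (2), TRUNK WORDS #5–#8, O7 OWNER WORD #12 (2): (h5) = the trunk): the assembly file for Kottwitz's criterion at a SINGULAR
non-central semisimple `γ₀ ∈ U(H)(L⁺)` (`(γ₀ − a)(γ₀ − b) = 0`, `a ≠ b`) over ★ P5″ `MatchingAdeleG₂.obsHasse_of_placewise` with `obs := singularObs`
(★ `SingularObstruction`).  This first edition lands the road-independent FINITE NON-SPLIT piece of (h5); the split-place clause (h2), the archimedean clause (h3), the
positivity∕currency bridge (h4) and the final composition follow as ED. 2 once their heads are ★.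

* §1 private block plumbing; the idempotent∕frame bridge `blockDet e X = det X₁` is ★ A-p18 `BlockDetFrame` (`blockDet_lagrangeIdem_eq_det`,
  typed from the trunk's draft of this file).
* §2 **`MatchingAdeleG₂.exists_localCartan_eq_of_adelicBlockDet_eq`** — (h5-fin) THE FINITE NON-SPLIT CLAUSE of P5″'s `hreal` at `obs := singularObs`:
  from the frame (plane first), a global framed `y ∈ Z(γ₀)` (`det y = 1`, blocks `Y_a ⊕ᶠ Y_b` with `det Y_a = k det H_a`, `det Y_b = k⁻¹ det H_b` — ★ (R6a-s)
  `exists_commute_hermStar_eq_of_frame`'s output) and the block-determinant class `adelicBlockDet γ₀ a b g = (k ⊗ 1) · σ_𝔸(z) z` (★ `singularObs_eq_zero_iff`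
  ∘ ★ `IsPrincipalAdelicNorm`) to `∃ t ∈ GL₃(L_v)` commuting with `(γ₀)_v` with `(x_g)_v = t⋆ (y ⊗ 1)_v t` at every finite `v` NON-SPLIT in `L` —
  ★ (P1-s) `exists_commute_twistGram_eq_of_det_blocks` fed with `hdet₁`∕`hdet₂` computed by the ★ bridge `blockDet_lagrangeIdem_eq_det` (`det y₁ = πᵥ(adelicBlockDet) = k N(z_v)`) and the
  total determinant ★ `det_adelicCartan` (`det y₂ = k⁻¹ N(det g_v ∕ z_v)`), the forms framed at `v` by ★ `exists_twistGram_frame_eq_finSum`, letters by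
  ★ `map_adeleToLocal_inv_mul_twistGram`.  No positivity is needed at finite places (`k` only enters through `σ k = k` upstream).

HONEST LABEL: nothing printed is consumed; (h2)(h3)(h4) and the gluing `hglue` (K6-α) are other hands' rows; HC_CM is proved only modulo the printed
citations until rung 0 closes.

## References
* [Rogawski1990] J. D. Rogawski, *Automorphic Representations of Unitary Groups in Three Variables*, Ann. of Math. Stud. 123 (1990), §3.3 Prop. 3.3.1 p. 22,
  §3.8 Prop. 3.8.1 pp. 27–30, §5.4 p. 72.
* [Kottwitz1986] R. E. Kottwitz, *Stable trace formula: elliptic singular terms*, Math. Ann. 275 (1986), §7 Prop. 7.1, §9.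
* [Jacobowitz1962] R. Jacobowitz, *Hermitian forms over local fields*, Amer. J. Math. 84 (1962), §3 Thm. 3.1.
-/

set_option autoImplicit false

noncomputable section

open NumberField IsDedekindDomain
open scoped Matrix MatrixGroups

namespace Literature.NumberTheory.Rogawski1990

open Literature.NumberTheory.Automorphic Literature.NumberTheory.Automorphic.UnitaryGroup
open Literature.AlgebraicGeometry.ShimuraVarieties (unitaryGroup)

/-! ## §1 Block plumbing (private copies; the `blockDet`∕frame bridge itself is ★ `BlockDetFrame`) -/

section Frame

variable {S : Type*} [CommRing S] {N₁ N₂ : ℕ}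

/-- `(A ⊕ᶠ B)(C ⊕ᶠ D) = AC ⊕ᶠ BD`. [folklore] -/
private theorem finSum_mul_finSum₀ (A C : Matrix (Fin N₁) (Fin N₁) S) (B D : Matrix (Fin N₂) (Fin N₂) S) :
    finSum N₁ N₂ A B * finSum N₁ N₂ C D = finSum N₁ N₂ (A * C) (B * D) := by
  simp only [finSum, Matrix.reindex_apply, Matrix.submatrix_mul_equiv, Matrix.fromBlocks_multiply, Matrix.mul_zero, Matrix.zero_mul,
    add_zero, zero_add]

/-- `det (A ⊕ᶠ B) = det A · det B`. [folklore] -/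
private theorem det_finSum₀ (A : Matrix (Fin N₁) (Fin N₁) S) (B : Matrix (Fin N₂) (Fin N₂) S) : (finSum N₁ N₂ A B).det = A.det * B.det := by
  rw [finSum, Matrix.det_reindex_self, Matrix.det_fromBlocks_zero₂₁]

end Frame

/-! ## §2 (h5-fin) The FINITE NON-SPLIT clause of `hreal` for `singularObs`: from the block-determinant class to a local Cartan-class identity -/

section FiniteNonsplit

variable {L : Type} [Field L] [NumberField L] [IsCMField L] {H : Matrix (Fin 3) (Fin 3) L} {γ₀ : (UnitaryGroup.cmDatum L 3 H).Rational}

/-- `πᵥ ∘ (· ⊗ 1)` intertwines `σ` on `L` with `σᵥ` on `L_v`. [folklore] -/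
private theorem adeleToLocal_algebraMap_conj (v : HeightOneSpectrum (𝓞 ↥(maximalRealSubfield L))) (r : L) :
    ((UnitaryGroup.adeleToLocal L v).comp (algebraMap L (AdeleRing (𝓞 L) L))) (cmConjRingHom L r) =
      UnitaryGroup.conjLocal L (IsCMField.complexConj L) v (((UnitaryGroup.adeleToLocal L v).comp (algebraMap L (AdeleRing (𝓞 L) L))) r) := by
  rw [RingHom.comp_apply, RingHom.comp_apply, ← adeleConj_algebraMap, ← UnitaryGroup.conjAdele_complexConj]
  exact UnitaryGroup.adeleToLocal_conj L (IsCMField.complexConj L) v _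

/-- `πᵥ` intertwines `σ_𝔸` with `σᵥ`. [folklore] -/
private theorem adeleToLocal_adeleConj (v : HeightOneSpectrum (𝓞 ↥(maximalRealSubfield L))) (x : AdeleRing (𝓞 L) L) :
    UnitaryGroup.adeleToLocal L v (adeleConj L x) = UnitaryGroup.conjLocal L (IsCMField.complexConj L) v (UnitaryGroup.adeleToLocal L v x) := by
  rw [← UnitaryGroup.conjAdele_complexConj]
  exact UnitaryGroup.adeleToLocal_conj L (IsCMField.complexConj L) v x

/-- A `Fin 1`-matrix is determined by its determinant. [folklore] -/
private theorem fin_one_eq_smul_of_det {S : Type*} [CommRing S] {M N : Matrix (Fin 1) (Fin 1) S} {c : S} (h : M.det = c * N.det) : M = c • N := by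
  ext i j
  have hi : i = 0 := Subsingleton.elim _ _
  have hj : j = 0 := Subsingleton.elim _ _
  subst hi
  subst hj
  rw [Matrix.smul_apply, smul_eq_mul, ← Matrix.det_fin_one M, ← Matrix.det_fin_one N, h]

/-- **(h5-fin) THE FINITE NON-SPLIT CLAUSE OF `hreal` AT `obs := singularObs`.**  Data: `H` hermitian non-degenerate over the CM field `L`; a
singular non-central semisimple `γ₀ ∈ U(H)(L⁺)` with its PLANE-FIRST frame `P` (`ᵗ(σP) H P = H_a ⊕ᶠ H_b`, `γ₀ P = P (a·1₂ ⊕ᶠ b·1₁)`, `a ≠ b`); a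
global `y ∈ Z(γ₀)`, `⋆`-symmetric with `det y = 1`, framed as `ᵗ(σP) (H y) P = Y_a ⊕ᶠ Y_b` with `det Y_a = k · det H_a`, `det Y_b = k⁻¹ · det H_b`
(★ (R6a-s) `exists_commute_hermStar_eq_of_frame`); a matching adèle `p` with adelic conjugator `g` whose block-determinant class is
`adelicBlockDet γ₀ a b g = (k ⊗ 1) · σ_𝔸(z) z` (★ `singularObs_eq_zero_iff` + ★ `IsPrincipalAdelicNorm`).  Then at every finite place `v` of `L⁺`
NON-SPLIT in `L` there is `t ∈ GL₃(L_v)` commuting with `(γ₀)_v` with `(x_g)_v = t⋆ (y ⊗ 1)_v t` — the `v`-clause of ★ P5″'s `hreal`.  Route: frame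
everything at `v`; `(H_g)_v` is block diagonal in the frame (★ `exists_twistGram_frame_eq_finSum`) with blocks `H_a y₁ ⊕ᶠ H_b y₂`; the ★ bridge `blockDet_lagrangeIdem_eq_det` gives
`det y₁ = πᵥ(adelicBlockDet) = k · N(z_v)`, the total determinant `det x_g = N(det g)` (★ `det_adelicCartan`) gives `det y₂ = k⁻¹ N(det g_v ∕ z_v)`; these
are exactly ★ (P1-s) `exists_commute_twistGram_eq_of_det_blocks`'s `hdet₁`, `hdet₂`. [cite: Rogawski1990, §3.8 Prop. 3.8.1 (d) p. 30; §3.3 (3.3.1) p. 22] [cite: Kottwitz1986, §7, §9] -/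
theorem MatchingAdeleG₂.exists_localCartan_eq_of_adelicBlockDet_eq (hH : (H.map (cmConjRingHom L))ᵀ = H) (hHd : H.det ≠ 0) {a b : L} (hab : a ≠ b)
    {P : GL (Fin 3) L} {Ha : Matrix (Fin 2) (Fin 2) L} {Hb : Matrix (Fin 1) (Fin 1) L}
    (hP : (((P : Matrix (Fin 3) (Fin 3) L)).map (cmConjRingHom L))ᵀ * H * (P : Matrix (Fin 3) (Fin 3) L) = finSum 2 1 Ha Hb)
    (hγP : (((γ₀ : unitaryGroup (cmConjRingHom L) H).val : GL (Fin 3) L) : Matrix (Fin 3) (Fin 3) L) * (P : Matrix (Fin 3) (Fin 3) L) =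
      (P : Matrix (Fin 3) (Fin 3) L) * finSum 2 1 (a • (1 : Matrix (Fin 2) (Fin 2) L)) (b • (1 : Matrix (Fin 1) (Fin 1) L)))
    {y : Matrix (Fin 3) (Fin 3) L} {Ya : Matrix (Fin 2) (Fin 2) L} {Yb : Matrix (Fin 1) (Fin 1) L} {k : L}
    (hys : hermStar (cmConjRingHom L) H y = y) (hy1 : y.det = 1)
    (hyP : (((P : Matrix (Fin 3) (Fin 3) L)).map (cmConjRingHom L))ᵀ * (H * y) * (P : Matrix (Fin 3) (Fin 3) L) = finSum 2 1 Ya Yb)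
    (hYa : Ya.det = k * Ha.det) (hYb : Yb.det = k⁻¹ * Hb.det) (hk0 : k ≠ 0)
    (p : MatchingAdeleG₂ L H H γ₀) (g : GL (Fin 3) (AdeleRing (𝓞 L) L))
    (hg : g * (((UnitaryGroup.cmDatum L 3 H).toAdelic γ₀).val : GL (Fin 3) (AdeleRing (𝓞 L) L)) * g⁻¹ = (p.adele.val : GL (Fin 3) (AdeleRing (𝓞 L) L)))
    {z : (AdeleRing (𝓞 L) L)ˣ}
    (hδ : adelicBlockDet γ₀ a b g = algebraMap L (AdeleRing (𝓞 L) L) k * (adeleConj L (z : AdeleRing (𝓞 L) L) * (z : AdeleRing (𝓞 L) L)))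
    (v : HeightOneSpectrum (𝓞 ↥(maximalRealSubfield L))) (w : UnitaryGroup.PlacesOver L v) (hw : IsCMField.complexConj L • w.1 = w.1) :
    ∃ t : GL (Fin 3) (UnitaryGroup.LocalRing L v),
      t * Matrix.GeneralLinearGroup.map (UnitaryGroup.adeleToLocal L v) (((UnitaryGroup.cmDatum L 3 H).toAdelic γ₀).val : GL (Fin 3) (AdeleRing (𝓞 L) L)) =
        Matrix.GeneralLinearGroup.map (UnitaryGroup.adeleToLocal L v) (((UnitaryGroup.cmDatum L 3 H).toAdelic γ₀).val : GL (Fin 3) (AdeleRing (𝓞 L) L)) * t ∧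
      ((H.map (algebraMap L (AdeleRing (𝓞 L) L)))⁻¹ * twistGram (adeleConj L) (H.map (algebraMap L (AdeleRing (𝓞 L) L))) (g : Matrix (Fin 3) (Fin 3) (AdeleRing (𝓞 L) L))).map
          (UnitaryGroup.adeleToLocal L v) =
        hermStar (UnitaryGroup.conjLocal L (IsCMField.complexConj L) v) ((H.map (algebraMap L (AdeleRing (𝓞 L) L))).map (UnitaryGroup.adeleToLocal L v))
            (t.val : Matrix (Fin 3) (Fin 3) (UnitaryGroup.LocalRing L v)) *
          (y.map (algebraMap L (AdeleRing (𝓞 L) L))).map (UnitaryGroup.adeleToLocal L v) * (t.val : Matrix (Fin 3) (Fin 3) (UnitaryGroup.LocalRing L v)) := by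
  -- LETTERS at `v`
  set 𝔸 := AdeleRing (𝓞 L) L with h𝔸
  set πv := UnitaryGroup.adeleToLocal L v with hπv
  set σv := UnitaryGroup.conjLocal L (IsCMField.complexConj L) v with hσv
  set F : L →+* UnitaryGroup.LocalRing L v := πv.comp (algebraMap L 𝔸) with hFdef
  have hF : ∀ r : L, F (cmConjRingHom L r) = σv (F r) := fun r => adeleToLocal_algebraMap_conj v r
  haveI : Algebra.IsQuadraticExtension ↥(maximalRealSubfield L) L := IsCMField.isQuadraticExtension L
  have hex : ∃ z : L, cmConjRingHom L z ≠ z := by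
    by_contra h
    apply IsCMField.complexConj_ne_one (K := L)
    ext z
    by_contra hz
    exact h ⟨z, fun e => hz (by rw [cmConjRingHom_apply] at e; rw [e, AlgEquiv.one_apply])⟩
  obtain ⟨δ, hδ0, hδσ⟩ := exists_ne_zero_map_eq_neg (σ := cmConjRingHom L) (IsCMField.complexConj_apply_apply L) hex
  have hcδ : IsCMField.complexConj L δ = -δ := hδσ
  have hσσv : ∀ x, σv (σv x) = x := Liu2021.LemD1OfPlace.conjLocal_conjLocal_apply L v (IsCMField.complexConj L) hcδ hδ0
  -- names for the mapped objects
  set Hv : Matrix (Fin 3) (Fin 3) (UnitaryGroup.LocalRing L v) := (H.map (algebraMap L 𝔸)).map πv with hHv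
  have hHvF : Hv = H.map F := by rw [hHv, Matrix.map_map]; rfl
  set Pv : GL (Fin 3) (UnitaryGroup.LocalRing L v) := Matrix.GeneralLinearGroup.map F P with hPvdef
  have hPv : Pv.val = (P : Matrix (Fin 3) (Fin 3) L).map F := rfl
  set γ𝔸 : GL (Fin 3) 𝔸 := ((UnitaryGroup.cmDatum L 3 H).toAdelic γ₀).val with hγ𝔸
  have hγ𝔸val : (γ𝔸 : Matrix (Fin 3) (Fin 3) 𝔸) = ((((γ₀ : unitaryGroup (cmConjRingHom L) H).val : GL (Fin 3) L) : Matrix (Fin 3) (Fin 3) L)).map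
      (algebraMap L 𝔸) := by
    rw [hγ𝔸, UnitaryGroup.coe_cmDatum_toAdelic, val_toAdeleGL]
  set γv : Matrix (Fin 3) (Fin 3) (UnitaryGroup.LocalRing L v) := (γ𝔸 : Matrix (Fin 3) (Fin 3) 𝔸).map πv with hγvdef
  have hγvF : γv = ((((γ₀ : unitaryGroup (cmConjRingHom L) H).val : GL (Fin 3) L) : Matrix (Fin 3) (Fin 3) L)).map F := by
    rw [hγvdef, hγ𝔸val, Matrix.map_map]; rfl
  set xg : Matrix (Fin 3) (Fin 3) 𝔸 := (H.map (algebraMap L 𝔸))⁻¹ * twistGram (adeleConj L) (H.map (algebraMap L 𝔸)) (g : Matrix (Fin 3) (Fin 3) 𝔸) with hxg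
  set xv : Matrix (Fin 3) (Fin 3) (UnitaryGroup.LocalRing L v) := xg.map πv with hxvdef
  -- unit determinants
  have hHu : IsUnit H.det := isUnit_iff_ne_zero.mpr hHd
  have hHvd : IsUnit Hv.det := by rw [hHvF, ← RingHom.mapMatrix_apply, ← RingHom.map_det]; exact hHu.map F
  have hFab : IsUnit (F a - F b) := by rw [← map_sub]; exact (IsUnit.mk0 _ (sub_ne_zero.mpr hab)).map F
  have hFk : IsUnit (F k) := (IsUnit.mk0 _ hk0).map F
  -- (1) the frame at `v`
  have hPv_frame : twistGram σv Hv Pv.val = finSum 2 1 (Ha.map F) (Hb.map F) := by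
    rw [hHvF, hPv, ← twistGram_map (cmConjRingHom L) H σv F hF, twistGram_def, hP, finSum_map]
  have hsmul1 : ∀ (n : ℕ) (c : L), (c • (1 : Matrix (Fin n) (Fin n) L)).map F = F c • (1 : Matrix (Fin n) (Fin n) (UnitaryGroup.LocalRing L v)) :=
    fun n c => by rw [Matrix.map_smul' _ _ _ (map_mul F), Matrix.map_one _ (map_zero F) (map_one F)]
  have hγv_frame : γv * Pv.val =
      Pv.val *
        finSum 2 1 (F a • (1 : Matrix (Fin 2) (Fin 2) (UnitaryGroup.LocalRing L v))) (F b • (1 : Matrix (Fin 1) (Fin 1) (UnitaryGroup.LocalRing L v))) := by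
    rw [hγvF, hPv, ← Matrix.map_mul, hγP, Matrix.map_mul, finSum_map, hsmul1, hsmul1]
  -- (2) the two hermitian forms at `v`: `G = (H y)_v`, `G' = (H_g)_v`
  set G : Matrix (Fin 3) (Fin 3) (UnitaryGroup.LocalRing L v) := (H * y).map F with hGdef
  set G' : Matrix (Fin 3) (Fin 3) (UnitaryGroup.LocalRing L v) := twistGram σv Hv ((g : Matrix (Fin 3) (Fin 3) 𝔸).map πv) with hG'def
  have hHy : ((H * y).map (cmConjRingHom L))ᵀ = H * y := by
    -- `y⋆ = y` reads `ᵗ(σy) H = H y` after clearing `H⁻¹`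
    have h := congrArg (fun M => H * M) hys
    simp only [hermStar_def, ← Matrix.mul_assoc, Matrix.mul_nonsing_inv _ hHu, Matrix.one_mul] at h
    rw [Matrix.map_mul, Matrix.transpose_mul, hH, h]
  have hσF : (⇑σv ∘ ⇑F : L → UnitaryGroup.LocalRing L v) = ⇑F ∘ ⇑(cmConjRingHom L) := funext fun r => (hF r).symm
  have hG : (G.map σv)ᵀ = G := by
    rw [hGdef, Matrix.map_map, hσF, ← Matrix.map_map, ← Matrix.transpose_map, hHy]
  have hσvHv : (Hv.map σv)ᵀ = Hv := by
    rw [hHvF, Matrix.map_map, hσF, ← Matrix.map_map, ← Matrix.transpose_map, hH]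
  have hG' : (G'.map σv)ᵀ = G' := conjTranspose_twistGram σv Hv hσσv hσvHv _
  have hGd : IsUnit G.det := by
    rw [hGdef, ← RingHom.mapMatrix_apply, ← RingHom.map_det, Matrix.det_mul, hy1, mul_one]; exact hHu.map F
  have hgvd : IsUnit ((g : Matrix (Fin 3) (Fin 3) 𝔸).map πv).det := by
    rw [← RingHom.mapMatrix_apply, ← RingHom.map_det]; exact (Matrix.isUnits_det_units g).map πv
  have hG'd : IsUnit G'.det := by
    rw [hG'def, det_twistGram]; exact ((hgvd.map σv).mul hHvd).mul hgvd
  -- (3) the frames of `G` and `G'`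
  have hGP : twistGram σv G Pv.val = finSum 2 1 (Ya.map F) (Yb.map F) := by
    rw [hGdef, hPv, ← twistGram_map (cmConjRingHom L) (H * y) σv F hF, twistGram_def, hyP, finSum_map]
  have hxv_eq : xv = Hv⁻¹ * G' := by
    rw [hxvdef, hxg, hG'def, hHv, hπv]; exact map_adeleToLocal_inv_mul_twistGram hHd v _
  have hxv_comm : Hv⁻¹ * G' * γv = γv * (Hv⁻¹ * G') := by
    rw [← hxv_eq, hxvdef, hγvdef, ← Matrix.map_mul, ← Matrix.map_mul]
    exact congrArg (fun M : Matrix (Fin 3) (Fin 3) 𝔸 => M.map ⇑πv) (commute_adelicCartan hHu p hg).eq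
  obtain ⟨y₁, y₂, hG'P⟩ := exists_twistGram_frame_eq_finSum (N₁ := 2) (N₂ := 1) σv hHvd hFab hPv_frame hγv_frame hxv_comm
  change Matrix (Fin 2) (Fin 2) (UnitaryGroup.LocalRing L v) at y₁
  change twistGram σv G' Pv.val = finSum 2 1 (Ha.map F * y₁) (Hb.map F * y₂) at hG'P
  -- (4) `x_v` in the frame and its determinants
  have hPu : IsUnit Pv.val.det := Matrix.isUnits_det_units Pv
  have hxvP : xv * Pv.val = Pv.val * finSum 2 1 y₁ y₂ := by
    have hfu : IsUnit (finSum 2 1 (Ha.map F) (Hb.map F)).det := by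
      rw [← hPv_frame, det_twistGram]; exact ((hPu.map σv).mul hHvd).mul hPu
    -- `ᵗ(σPᵥ) Hᵥ Pᵥ · (Pᵥ⁻¹ xᵥ Pᵥ) = ᵗ(σPᵥ) G' Pᵥ`
    have h1 : finSum 2 1 (Ha.map F) (Hb.map F) * (Pv.val⁻¹ * xv * Pv.val) = finSum 2 1 (Ha.map F) (Hb.map F) * finSum 2 1 y₁ y₂ := by
      rw [finSum_mul_finSum₀, ← hG'P, ← hPv_frame, twistGram_def, twistGram_def, hxv_eq]
      simp only [Matrix.mul_assoc]
      rw [Matrix.mul_nonsing_inv_cancel_left _ _ hPu, Matrix.mul_nonsing_inv_cancel_left _ _ hHvd]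
    have h2 : Pv.val⁻¹ * xv * Pv.val = finSum 2 1 y₁ y₂ := by
      have h := congrArg (fun M => (finSum 2 1 (Ha.map F) (Hb.map F))⁻¹ * M) h1
      simpa only [← Matrix.mul_assoc, Matrix.nonsing_inv_mul _ hfu, Matrix.one_mul] using h
    rw [← h2, ← Matrix.mul_assoc, ← Matrix.mul_assoc, Matrix.mul_nonsing_inv _ hPu, Matrix.one_mul]
  -- the Lagrange idempotent at `v` and the `a`-block determinant
  have hev : (adelicLagrangeIdem γ₀ a b).map ⇑πv = F (a - b)⁻¹ • (γv - F b • (1 : Matrix (Fin 3) (Fin 3) (UnitaryGroup.LocalRing L v))) := by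
    rw [adelicLagrangeIdem_eq, Matrix.map_smul' _ _ _ (map_mul πv), Matrix.map_sub _ (map_sub πv), Matrix.map_smul' _ _ _ (map_mul πv),
      Matrix.map_one _ (map_zero πv) (map_one πv), hγvdef, hγ𝔸]
    rfl
  have hu : F (a - b)⁻¹ * (F a - F b) = 1 := by
    rw [← map_sub, ← map_mul, inv_mul_cancel₀ (sub_ne_zero.2 hab), map_one]
  have hdet₁' : y₁.det = F k * (σv (πv (z : 𝔸)) * πv (z : 𝔸)) := by
    rw [← blockDet_lagrangeIdem_eq_det (N₁ := 2) (N₂ := 1) (P := Pv) hγv_frame hu hxvP, ← hev, hxvdef, hxg, blockDet_map, ← adelicBlockDet_def, hδ, map_mul, map_mul,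
      adeleToLocal_adeleConj]
    rfl
  have hxgdet : xv.det = σv (πv (g : Matrix (Fin 3) (Fin 3) 𝔸).det) * πv (g : Matrix (Fin 3) (Fin 3) 𝔸).det := by
    rw [hxvdef, ← RingHom.mapMatrix_apply, ← RingHom.map_det, hxg, det_adelicCartan hHu, map_mul, adeleToLocal_adeleConj]
  have hdet₂' : y₂.det * (F k * (σv (πv (z : 𝔸)) * πv (z : 𝔸))) = σv (πv (g : Matrix (Fin 3) (Fin 3) 𝔸).det) * πv (g : Matrix (Fin 3) (Fin 3) 𝔸).det := by
    have hfin : finSum 2 1 y₁ y₂ = Pv.val⁻¹ * xv * Pv.val := by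
      rw [Matrix.mul_assoc, hxvP, ← Matrix.mul_assoc, Matrix.nonsing_inv_mul _ hPu, Matrix.one_mul]
    have h := congrArg Matrix.det hfin
    rw [det_finSum₀, Matrix.det_conj' Pv.isUnit, hxgdet, hdet₁'] at h
    rw [mul_comm]
    exact h
  -- (5) the block-determinant classes `hdet₁`, `hdet₂` of ★ (P1-s)
  have hdet₁ : ∃ z' : UnitaryGroup.LocalRing L v, IsUnit z' ∧ (Ha.map F * y₁).det = (Ya.map F).det * (σv z' * z') := by
    refine ⟨πv (z : 𝔸), (Units.isUnit z).map πv, ?_⟩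
    rw [Matrix.det_mul, hdet₁', ← RingHom.mapMatrix_apply F Ya, ← RingHom.map_det, hYa, map_mul, ← RingHom.mapMatrix_apply, ← RingHom.map_det]
    ring
  have hdet₂ : ∃ z' : UnitaryGroup.LocalRing L v, IsUnit z' ∧ Hb.map F * y₂ = (σv z' * z') • Yb.map F := by
    refine ⟨πv (g : Matrix (Fin 3) (Fin 3) 𝔸).det * πv ((z⁻¹ : (AdeleRing (𝓞 L) L)ˣ) : 𝔸),
      ((Matrix.isUnits_det_units g).map πv).mul ((Units.isUnit z⁻¹).map πv), fin_one_eq_smul_of_det ?_⟩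
    have hYbv : (Yb.map F).det = F k⁻¹ * (Hb.map F).det := by
      rw [← RingHom.mapMatrix_apply, ← RingHom.map_det, hYb, map_mul, ← RingHom.mapMatrix_apply F Hb, ← RingHom.map_det]
    have hkk : F k⁻¹ * F k = 1 := by rw [← map_mul, inv_mul_cancel₀ hk0, map_one]
    have hzz : πv ((z⁻¹ : (AdeleRing (𝓞 L) L)ˣ) : 𝔸) * πv (z : 𝔸) = 1 := by rw [← map_mul, Units.inv_mul, map_one]
    have hσzz : σv (πv ((z⁻¹ : (AdeleRing (𝓞 L) L)ˣ) : 𝔸)) * σv (πv (z : 𝔸)) = 1 := by rw [← map_mul, hzz, map_one]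
    rw [Matrix.det_mul, hYbv, map_mul]
    linear_combination (σv (πv ((z⁻¹ : (AdeleRing (𝓞 L) L)ˣ) : 𝔸)) * πv ((z⁻¹ : (AdeleRing (𝓞 L) L)ˣ) : 𝔸) * F k⁻¹ * (Hb.map F).det) * hdet₂' +
      (-((Hb.map F).det * y₂.det * (πv ((z⁻¹ : (AdeleRing (𝓞 L) L)ˣ) : 𝔸) * πv (z : 𝔸)) * (F k⁻¹ * F k))) * hσzz +
      (-((Hb.map F).det * y₂.det * (F k⁻¹ * F k))) * hzz + (-((Hb.map F).det * y₂.det)) * hkk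
  -- (6) ★ (P1-s): a `γ`-centralising congruence `ᵗ(σt) G t = G'`
  obtain ⟨t, htγ, htG⟩ := exists_commute_twistGram_eq_of_det_blocks L v (IsCMField.complexConj L) hcδ hδ0 w hw hG hG' hGd hG'd hγv_frame hGP hG'P
    hdet₁ hdet₂
  refine ⟨t, Units.ext ?_, ?_⟩
  · show t.val * (γ𝔸 : Matrix (Fin 3) (Fin 3) 𝔸).map πv = (γ𝔸 : Matrix (Fin 3) (Fin 3) 𝔸).map πv * t.val
    exact htγ
  · -- `x_v = Hv⁻¹ G' = Hv⁻¹ ᵗ(σt) (H y)_v t = t⋆ y_v t`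
    rw [hxv_eq, ← htG, twistGram_def, hGdef, Matrix.map_mul, hermStar_def, Matrix.map_map, hHvF]
    simp only [← Matrix.mul_assoc]
    rfl

end FiniteNonsplit


/-! ## §3 (ED. 2) The SPLIT clause and the assembled finite clause `∀ v` of `hreal` at `obs := singularObs` -/

section FiniteSplit

variable {L : Type} [Field L] [NumberField L] [IsCMField L] {H : Matrix (Fin 3) (Fin 3) L} {γ₀ : (UnitaryGroup.cmDatum L 3 H).Rational}

/-- **(h5-split) THE FINITE SPLIT CLAUSE OF `hreal` AT `obs := singularObs`.**  At a finite place `v` of `L⁺` SPLIT in `L` no block-determinant class is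
needed: any two framed non-degenerate hermitian forms over `L_v = L_w × L_{w̄}` are congruent by a `γ`-centralising `t` (★ (h2)
`exists_commute_twistGram_eq_of_split`), so the local Cartan-class identity `(x_g)_v = t⋆ (y ⊗ 1)_v t` holds for the framed global `y` with no
hypothesis on `k`. [cite: Rogawski1990, §3.8 Prop. 3.8.1 (d) p. 30] [cite: Kottwitz1986, §7] -/
theorem MatchingAdeleG₂.exists_localCartan_eq_of_split (hH : (H.map (cmConjRingHom L))ᵀ = H) (hHd : H.det ≠ 0) {a b : L} (hab : a ≠ b)
    {P : GL (Fin 3) L} {Ha : Matrix (Fin 2) (Fin 2) L} {Hb : Matrix (Fin 1) (Fin 1) L}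
    (hP : (((P : Matrix (Fin 3) (Fin 3) L)).map (cmConjRingHom L))ᵀ * H * (P : Matrix (Fin 3) (Fin 3) L) = finSum 2 1 Ha Hb)
    (hγP : (((γ₀ : unitaryGroup (cmConjRingHom L) H).val : GL (Fin 3) L) : Matrix (Fin 3) (Fin 3) L) * (P : Matrix (Fin 3) (Fin 3) L) =
      (P : Matrix (Fin 3) (Fin 3) L) * finSum 2 1 (a • (1 : Matrix (Fin 2) (Fin 2) L)) (b • (1 : Matrix (Fin 1) (Fin 1) L)))
    {y : Matrix (Fin 3) (Fin 3) L} {Ya : Matrix (Fin 2) (Fin 2) L} {Yb : Matrix (Fin 1) (Fin 1) L}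
    (hys : hermStar (cmConjRingHom L) H y = y) (hy1 : y.det = 1)
    (hyP : (((P : Matrix (Fin 3) (Fin 3) L)).map (cmConjRingHom L))ᵀ * (H * y) * (P : Matrix (Fin 3) (Fin 3) L) = finSum 2 1 Ya Yb)
    (p : MatchingAdeleG₂ L H H γ₀) (g : GL (Fin 3) (AdeleRing (𝓞 L) L))
    (hg : g * (((UnitaryGroup.cmDatum L 3 H).toAdelic γ₀).val : GL (Fin 3) (AdeleRing (𝓞 L) L)) * g⁻¹ = (p.adele.val : GL (Fin 3) (AdeleRing (𝓞 L) L)))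
    (v : HeightOneSpectrum (𝓞 ↥(maximalRealSubfield L))) (w : UnitaryGroup.PlacesOver L v) (hw : IsCMField.complexConj L • w.1 ≠ w.1) :
    ∃ t : GL (Fin 3) (UnitaryGroup.LocalRing L v),
      t * Matrix.GeneralLinearGroup.map (UnitaryGroup.adeleToLocal L v) (((UnitaryGroup.cmDatum L 3 H).toAdelic γ₀).val : GL (Fin 3) (AdeleRing (𝓞 L) L)) =
        Matrix.GeneralLinearGroup.map (UnitaryGroup.adeleToLocal L v) (((UnitaryGroup.cmDatum L 3 H).toAdelic γ₀).val : GL (Fin 3) (AdeleRing (𝓞 L) L)) * t ∧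
      ((H.map (algebraMap L (AdeleRing (𝓞 L) L)))⁻¹ * twistGram (adeleConj L) (H.map (algebraMap L (AdeleRing (𝓞 L) L))) (g : Matrix (Fin 3) (Fin 3) (AdeleRing (𝓞 L) L))).map
          (UnitaryGroup.adeleToLocal L v) =
        hermStar (UnitaryGroup.conjLocal L (IsCMField.complexConj L) v) ((H.map (algebraMap L (AdeleRing (𝓞 L) L))).map (UnitaryGroup.adeleToLocal L v))
            (t.val : Matrix (Fin 3) (Fin 3) (UnitaryGroup.LocalRing L v)) *
          (y.map (algebraMap L (AdeleRing (𝓞 L) L))).map (UnitaryGroup.adeleToLocal L v) * (t.val : Matrix (Fin 3) (Fin 3) (UnitaryGroup.LocalRing L v)) := by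
  -- LETTERS at `v`
  set 𝔸 := AdeleRing (𝓞 L) L with h𝔸
  set πv := UnitaryGroup.adeleToLocal L v with hπv
  set σv := UnitaryGroup.conjLocal L (IsCMField.complexConj L) v with hσv
  set F : L →+* UnitaryGroup.LocalRing L v := πv.comp (algebraMap L 𝔸) with hFdef
  have hF : ∀ r : L, F (cmConjRingHom L r) = σv (F r) := fun r => adeleToLocal_algebraMap_conj v r
  haveI : Algebra.IsQuadraticExtension ↥(maximalRealSubfield L) L := IsCMField.isQuadraticExtension L
  have hex : ∃ z : L, cmConjRingHom L z ≠ z := by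
    by_contra h
    apply IsCMField.complexConj_ne_one (K := L)
    ext z
    by_contra hz
    exact h ⟨z, fun e => hz (by rw [cmConjRingHom_apply] at e; rw [e, AlgEquiv.one_apply])⟩
  obtain ⟨δ, hδ0, hδσ⟩ := exists_ne_zero_map_eq_neg (σ := cmConjRingHom L) (IsCMField.complexConj_apply_apply L) hex
  have hcδ : IsCMField.complexConj L δ = -δ := hδσ
  have hσσv : ∀ x, σv (σv x) = x := Liu2021.LemD1OfPlace.conjLocal_conjLocal_apply L v (IsCMField.complexConj L) hcδ hδ0
  -- names for the mapped objects
  set Hv : Matrix (Fin 3) (Fin 3) (UnitaryGroup.LocalRing L v) := (H.map (algebraMap L 𝔸)).map πv with hHv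
  have hHvF : Hv = H.map F := by rw [hHv, Matrix.map_map]; rfl
  set Pv : GL (Fin 3) (UnitaryGroup.LocalRing L v) := Matrix.GeneralLinearGroup.map F P with hPvdef
  have hPv : Pv.val = (P : Matrix (Fin 3) (Fin 3) L).map F := rfl
  set γ𝔸 : GL (Fin 3) 𝔸 := ((UnitaryGroup.cmDatum L 3 H).toAdelic γ₀).val with hγ𝔸
  have hγ𝔸val : (γ𝔸 : Matrix (Fin 3) (Fin 3) 𝔸) = ((((γ₀ : unitaryGroup (cmConjRingHom L) H).val : GL (Fin 3) L) : Matrix (Fin 3) (Fin 3) L)).map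
      (algebraMap L 𝔸) := by
    rw [hγ𝔸, UnitaryGroup.coe_cmDatum_toAdelic, val_toAdeleGL]
  set γv : Matrix (Fin 3) (Fin 3) (UnitaryGroup.LocalRing L v) := (γ𝔸 : Matrix (Fin 3) (Fin 3) 𝔸).map πv with hγvdef
  have hγvF : γv = ((((γ₀ : unitaryGroup (cmConjRingHom L) H).val : GL (Fin 3) L) : Matrix (Fin 3) (Fin 3) L)).map F := by
    rw [hγvdef, hγ𝔸val, Matrix.map_map]; rfl
  set xg : Matrix (Fin 3) (Fin 3) 𝔸 := (H.map (algebraMap L 𝔸))⁻¹ * twistGram (adeleConj L) (H.map (algebraMap L 𝔸)) (g : Matrix (Fin 3) (Fin 3) 𝔸) with hxg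
  set xv : Matrix (Fin 3) (Fin 3) (UnitaryGroup.LocalRing L v) := xg.map πv with hxvdef
  -- unit determinants
  have hHu : IsUnit H.det := isUnit_iff_ne_zero.mpr hHd
  have hHvd : IsUnit Hv.det := by rw [hHvF, ← RingHom.mapMatrix_apply, ← RingHom.map_det]; exact hHu.map F
  have hFab : IsUnit (F a - F b) := by rw [← map_sub]; exact (IsUnit.mk0 _ (sub_ne_zero.mpr hab)).map F
  -- (1) the frame at `v`
  have hPv_frame : twistGram σv Hv Pv.val = finSum 2 1 (Ha.map F) (Hb.map F) := by
    rw [hHvF, hPv, ← twistGram_map (cmConjRingHom L) H σv F hF, twistGram_def, hP, finSum_map]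
  have hsmul1 : ∀ (n : ℕ) (c : L), (c • (1 : Matrix (Fin n) (Fin n) L)).map F = F c • (1 : Matrix (Fin n) (Fin n) (UnitaryGroup.LocalRing L v)) :=
    fun n c => by rw [Matrix.map_smul' _ _ _ (map_mul F), Matrix.map_one _ (map_zero F) (map_one F)]
  have hγv_frame : γv * Pv.val =
      Pv.val *
        finSum 2 1 (F a • (1 : Matrix (Fin 2) (Fin 2) (UnitaryGroup.LocalRing L v))) (F b • (1 : Matrix (Fin 1) (Fin 1) (UnitaryGroup.LocalRing L v))) := by
    rw [hγvF, hPv, ← Matrix.map_mul, hγP, Matrix.map_mul, finSum_map, hsmul1, hsmul1]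
  -- (2) the two hermitian forms at `v`: `G = (H y)_v`, `G' = (H_g)_v`
  set G : Matrix (Fin 3) (Fin 3) (UnitaryGroup.LocalRing L v) := (H * y).map F with hGdef
  set G' : Matrix (Fin 3) (Fin 3) (UnitaryGroup.LocalRing L v) := twistGram σv Hv ((g : Matrix (Fin 3) (Fin 3) 𝔸).map πv) with hG'def
  have hHy : ((H * y).map (cmConjRingHom L))ᵀ = H * y := by
    -- `y⋆ = y` reads `ᵗ(σy) H = H y` after clearing `H⁻¹`
    have h := congrArg (fun M => H * M) hys
    simp only [hermStar_def, ← Matrix.mul_assoc, Matrix.mul_nonsing_inv _ hHu, Matrix.one_mul] at h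
    rw [Matrix.map_mul, Matrix.transpose_mul, hH, h]
  have hσF : (⇑σv ∘ ⇑F : L → UnitaryGroup.LocalRing L v) = ⇑F ∘ ⇑(cmConjRingHom L) := funext fun r => (hF r).symm
  have hG : (G.map σv)ᵀ = G := by
    rw [hGdef, Matrix.map_map, hσF, ← Matrix.map_map, ← Matrix.transpose_map, hHy]
  have hσvHv : (Hv.map σv)ᵀ = Hv := by
    rw [hHvF, Matrix.map_map, hσF, ← Matrix.map_map, ← Matrix.transpose_map, hH]
  have hG' : (G'.map σv)ᵀ = G' := conjTranspose_twistGram σv Hv hσσv hσvHv _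
  have hGd : IsUnit G.det := by
    rw [hGdef, ← RingHom.mapMatrix_apply, ← RingHom.map_det, Matrix.det_mul, hy1, mul_one]; exact hHu.map F
  have hgvd : IsUnit ((g : Matrix (Fin 3) (Fin 3) 𝔸).map πv).det := by
    rw [← RingHom.mapMatrix_apply, ← RingHom.map_det]; exact (Matrix.isUnits_det_units g).map πv
  have hG'd : IsUnit G'.det := by
    rw [hG'def, det_twistGram]; exact ((hgvd.map σv).mul hHvd).mul hgvd
  -- (3) the frames of `G` and `G'`
  have hGP : twistGram σv G Pv.val = finSum 2 1 (Ya.map F) (Yb.map F) := by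
    rw [hGdef, hPv, ← twistGram_map (cmConjRingHom L) (H * y) σv F hF, twistGram_def, hyP, finSum_map]
  have hxv_eq : xv = Hv⁻¹ * G' := by
    rw [hxvdef, hxg, hG'def, hHv, hπv]; exact map_adeleToLocal_inv_mul_twistGram hHd v _
  have hxv_comm : Hv⁻¹ * G' * γv = γv * (Hv⁻¹ * G') := by
    rw [← hxv_eq, hxvdef, hγvdef, ← Matrix.map_mul, ← Matrix.map_mul]
    exact congrArg (fun M : Matrix (Fin 3) (Fin 3) 𝔸 => M.map ⇑πv) (commute_adelicCartan hHu p hg).eq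
  obtain ⟨y₁, y₂, hG'P⟩ := exists_twistGram_frame_eq_finSum (N₁ := 2) (N₂ := 1) σv hHvd hFab hPv_frame hγv_frame hxv_comm
  change Matrix (Fin 2) (Fin 2) (UnitaryGroup.LocalRing L v) at y₁
  change twistGram σv G' Pv.val = finSum 2 1 (Ha.map F * y₁) (Hb.map F * y₂) at hG'P
  -- ★ (h2): at a SPLIT place every two framed hermitian forms are congruent by a `γ`-centralising `t`
  obtain ⟨t, htγ, htG⟩ := exists_commute_twistGram_eq_of_split L v (IsCMField.complexConj L) hcδ hδ0 w hw hG hG' hGd hG'd hγv_frame hGP hG'P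
  refine ⟨t, Units.ext ?_, ?_⟩
  · show t.val * (γ𝔸 : Matrix (Fin 3) (Fin 3) 𝔸).map πv = (γ𝔸 : Matrix (Fin 3) (Fin 3) 𝔸).map πv * t.val
    exact htγ
  · -- `x_v = Hv⁻¹ G' = Hv⁻¹ ᵗ(σt) (H y)_v t = t⋆ y_v t`
    rw [hxv_eq, ← htG, twistGram_def, hGdef, Matrix.map_mul, hermStar_def, Matrix.map_map, hHvF]
    simp only [← Matrix.mul_assoc]
    rfl


/-- **THE FINITE CLAUSE (clause 6) OF P5″'s `hreal` AT `obs := singularObs`, ALL FINITE PLACES**: split places by `exists_localCartan_eq_of_split`,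
non-split places by ED. 1's `exists_localCartan_eq_of_adelicBlockDet_eq` (a place of `L` over `v` exists: ★ `PlacesOver.nonempty`).
[cite: Rogawski1990, §3.8 Prop. 3.8.1 (d) p. 30; §3.3 (3.3.1) p. 22] [cite: Kottwitz1986, §7, §9] -/
theorem MatchingAdeleG₂.forall_exists_localCartan_eq_of_adelicBlockDet_eq (hH : (H.map (cmConjRingHom L))ᵀ = H) (hHd : H.det ≠ 0) {a b : L} (hab : a ≠ b)
    {P : GL (Fin 3) L} {Ha : Matrix (Fin 2) (Fin 2) L} {Hb : Matrix (Fin 1) (Fin 1) L}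
    (hP : (((P : Matrix (Fin 3) (Fin 3) L)).map (cmConjRingHom L))ᵀ * H * (P : Matrix (Fin 3) (Fin 3) L) = finSum 2 1 Ha Hb)
    (hγP : (((γ₀ : unitaryGroup (cmConjRingHom L) H).val : GL (Fin 3) L) : Matrix (Fin 3) (Fin 3) L) * (P : Matrix (Fin 3) (Fin 3) L) =
      (P : Matrix (Fin 3) (Fin 3) L) * finSum 2 1 (a • (1 : Matrix (Fin 2) (Fin 2) L)) (b • (1 : Matrix (Fin 1) (Fin 1) L)))
    {y : Matrix (Fin 3) (Fin 3) L} {Ya : Matrix (Fin 2) (Fin 2) L} {Yb : Matrix (Fin 1) (Fin 1) L} {k : L}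
    (hys : hermStar (cmConjRingHom L) H y = y) (hy1 : y.det = 1)
    (hyP : (((P : Matrix (Fin 3) (Fin 3) L)).map (cmConjRingHom L))ᵀ * (H * y) * (P : Matrix (Fin 3) (Fin 3) L) = finSum 2 1 Ya Yb)
    (hYa : Ya.det = k * Ha.det) (hYb : Yb.det = k⁻¹ * Hb.det) (hk0 : k ≠ 0)
    (p : MatchingAdeleG₂ L H H γ₀) (g : GL (Fin 3) (AdeleRing (𝓞 L) L))
    (hg : g * (((UnitaryGroup.cmDatum L 3 H).toAdelic γ₀).val : GL (Fin 3) (AdeleRing (𝓞 L) L)) * g⁻¹ = (p.adele.val : GL (Fin 3) (AdeleRing (𝓞 L) L)))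
    {z : (AdeleRing (𝓞 L) L)ˣ}
    (hδ : adelicBlockDet γ₀ a b g = algebraMap L (AdeleRing (𝓞 L) L) k * (adeleConj L (z : AdeleRing (𝓞 L) L) * (z : AdeleRing (𝓞 L) L)))
    (v : HeightOneSpectrum (𝓞 ↥(maximalRealSubfield L))) :
    ∃ t : GL (Fin 3) (UnitaryGroup.LocalRing L v),
      t * Matrix.GeneralLinearGroup.map (UnitaryGroup.adeleToLocal L v) (((UnitaryGroup.cmDatum L 3 H).toAdelic γ₀).val : GL (Fin 3) (AdeleRing (𝓞 L) L)) =
        Matrix.GeneralLinearGroup.map (UnitaryGroup.adeleToLocal L v) (((UnitaryGroup.cmDatum L 3 H).toAdelic γ₀).val : GL (Fin 3) (AdeleRing (𝓞 L) L)) * t ∧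
      ((H.map (algebraMap L (AdeleRing (𝓞 L) L)))⁻¹ * twistGram (adeleConj L) (H.map (algebraMap L (AdeleRing (𝓞 L) L))) (g : Matrix (Fin 3) (Fin 3) (AdeleRing (𝓞 L) L))).map
          (UnitaryGroup.adeleToLocal L v) =
        hermStar (UnitaryGroup.conjLocal L (IsCMField.complexConj L) v) ((H.map (algebraMap L (AdeleRing (𝓞 L) L))).map (UnitaryGroup.adeleToLocal L v))
            (t.val : Matrix (Fin 3) (Fin 3) (UnitaryGroup.LocalRing L v)) *
          (y.map (algebraMap L (AdeleRing (𝓞 L) L))).map (UnitaryGroup.adeleToLocal L v) * (t.val : Matrix (Fin 3) (Fin 3) (UnitaryGroup.LocalRing L v)) := by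
  obtain ⟨w⟩ : Nonempty (UnitaryGroup.PlacesOver L v) := inferInstance
  by_cases hw : IsCMField.complexConj L • w.1 = w.1
  · exact MatchingAdeleG₂.exists_localCartan_eq_of_adelicBlockDet_eq hH hHd hab hP hγP hys hy1 hyP hYa hYb hk0 p g hg hδ v w hw
  · exact MatchingAdeleG₂.exists_localCartan_eq_of_split hH hHd hab hP hγP hys hy1 hyP p g hg v w hw

end FiniteSplit


/-! ## §4 (ED. 3) The gluing `hglue` DISCHARGED for anisotropic `H`, and the singular Hasse MODULO the realisation clause `hreal` -/

section Closer

variable {L : Type} [Field L] [NumberField L] [IsCMField L] {H : Matrix (Fin 3) (Fin 3) L} {γ₀ : (UnitaryGroup.cmDatum L 3 H).Rational}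

/-- **`hglue` of ★ P5″ holds at EVERY stable class of an anisotropic `U(H)`** (K6-α in house): a rational `δ` that is conjugate to the matching adèle `p`
at `∞` and at every finite place is `U(H)(𝐀)`-conjugate to `p` — ★ (P3-s) §4 `isRationalOver_of_isConj_arch_of_forall_isConj_toLocal_of_integralConj` with
its a.e.-integral-conjugacy clause discharged by ★ FILE 3 `eventually_forall_integralConj_cmDatum_of_isSemisimpleElt` (every element of an anisotropic
unitary group is semisimple, ★ `isSemisimpleElt_of_anisotropic`). [cite: Rogawski1990, §3.3 Prop. 3.3.1 p. 22; §5.4 p. 72] [cite: Kottwitz1986, §7 Prop. 7.1] -/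
theorem MatchingAdeleG₂.hglue_of_anisotropic (hH : (H.map (cmConjRingHom L))ᵀ = H) (hHd : H.det ≠ 0)
    (hanis : ∀ v : Fin 3 → L, hermForm (cmConjRingHom L) H v v = 0 → v = 0)
    (p : MatchingAdeleG₂ L H H γ₀) (δ : (UnitaryGroup.cmDatum L 3 H).Rational)
    (_hst : IsStablyConj (cmConjRingHom L) H (γ₀ : unitaryGroup (cmConjRingHom L) H) (δ : unitaryGroup (cmConjRingHom L) H))
    (ha : IsConj (cmRationalToArch L 3 H δ) p.arch)
    (hv : ∀ v : HeightOneSpectrum (𝓞 ↥(maximalRealSubfield L)),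
      IsConj ((UnitaryGroup.cmDatum L 3 H).toLocal v ((UnitaryGroup.cmDatum L 3 H).toAdelic δ)) ((UnitaryGroup.cmDatum L 3 H).toLocal v p.adele)) :
    p.IsRationalOver δ :=
  p.isRationalOver_of_isConj_arch_of_forall_isConj_toLocal_of_integralConj
    (eventually_forall_integralConj_cmDatum_of_isSemisimpleElt L H hH hHd δ
      (isSemisimpleElt_of_anisotropic (cmConjRingHom L) H hanis (δ : unitaryGroup (cmConjRingHom L) H))) ha hv

/-- **THE SINGULAR HASSE MODULO THE REALISATION CLAUSE `hreal`** (Prop. 3.3.1 ∕ Prop. 3.8.1 for Kottwitz's `singularObs` of an anisotropic `U(H)`, `|𝓡| = 2`):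
★ P5″ `obsHasse_of_placewise` with `obs := singularObs hab hγ₀`, `hconj` := ★ (P3-s), `hglue` := `hglue_of_anisotropic`, `hvan` := ★
`singularObs_eq_zero_of_adelicCartan_eq`, `hlocFin`∕`hlocArch` := ★ hloc-place; the ONE remaining hypothesis is P5″'s (⇒)-half `hreal` at this `obs`
(assembled in the next edition from ★ `singularObs_eq_zero_iff` + ★ (h5-sign) + ★ (R6a-s′) + ★ clause 6 (§3) + ★ (h5-arch)).
[cite: Rogawski1990, §3.3 Prop. 3.3.1 p. 22; §3.8 Prop. 3.8.1 (d) p. 30; §5.4 p. 72] [cite: Kottwitz1986, §7 Prop. 7.1, §9] -/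
theorem MatchingAdeleG₂.singularObsHasse_of_hreal (hH : (H.map (cmConjRingHom L))ᵀ = H) (hHd : H.det ≠ 0)
    (hanis : ∀ v : Fin 3 → L, hermForm (cmConjRingHom L) H v v = 0 → v = 0) {a b : L} (hab : a ≠ b)
    (ha : a * cmConjRingHom L a = 1) (hb : b * cmConjRingHom L b = 1)
    (hγ₀ : ((((γ₀ : unitaryGroup (cmConjRingHom L) H).val : GL (Fin 3) L) : Matrix (Fin 3) (Fin 3) L) - a • (1 : Matrix (Fin 3) (Fin 3) L)) *
      ((((γ₀ : unitaryGroup (cmConjRingHom L) H).val : GL (Fin 3) L) : Matrix (Fin 3) (Fin 3) L) - b • (1 : Matrix (Fin 3) (Fin 3) L)) = 0)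
    (hreal : ∀ (p : MatchingAdeleG₂ L H H γ₀) (g : GL (Fin 3) (AdeleRing (𝓞 L) L)),
      g * (((UnitaryGroup.cmDatum L 3 H).toAdelic γ₀).val : GL (Fin 3) (AdeleRing (𝓞 L) L)) * g⁻¹ = (p.adele.val : GL (Fin 3) (AdeleRing (𝓞 L) L)) →
      p.singularObs hab hγ₀ = 0 →
      ∃ y : Matrix (Fin 3) (Fin 3) L,
        Commute y (((γ₀ : unitaryGroup (cmConjRingHom L) H).val : GL (Fin 3) L) : Matrix (Fin 3) (Fin 3) L) ∧
        hermStar (cmConjRingHom L) H y = y ∧ IsUnit y.det ∧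
        (∃ z : L, z ≠ 0 ∧ y.det = z * cmConjRingHom L z) ∧
        (∀ (ρ : L →+* ℂ) (h₁ : (H.map ρ).IsHermitian) (h₂ : ((H * y).map ρ).IsHermitian),
          (Finset.univ.filter fun i => 0 < h₁.eigenvalues i).card = (Finset.univ.filter fun i => 0 < h₂.eigenvalues i).card) ∧
        (∀ v : HeightOneSpectrum (𝓞 ↥(maximalRealSubfield L)), ∃ t : GL (Fin 3) (UnitaryGroup.LocalRing L v),
          t * Matrix.GeneralLinearGroup.map (UnitaryGroup.adeleToLocal L v) (((UnitaryGroup.cmDatum L 3 H).toAdelic γ₀).val : GL (Fin 3) (AdeleRing (𝓞 L) L)) =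
            Matrix.GeneralLinearGroup.map (UnitaryGroup.adeleToLocal L v) (((UnitaryGroup.cmDatum L 3 H).toAdelic γ₀).val : GL (Fin 3) (AdeleRing (𝓞 L) L)) * t ∧
          ((H.map (algebraMap L (AdeleRing (𝓞 L) L)))⁻¹ * twistGram (adeleConj L) (H.map (algebraMap L (AdeleRing (𝓞 L) L))) (g : Matrix (Fin 3) (Fin 3) (AdeleRing (𝓞 L) L))).map
              (UnitaryGroup.adeleToLocal L v) =
            hermStar (UnitaryGroup.conjLocal L (IsCMField.complexConj L) v) ((H.map (algebraMap L (AdeleRing (𝓞 L) L))).map (UnitaryGroup.adeleToLocal L v))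
                (t.val : Matrix (Fin 3) (Fin 3) (UnitaryGroup.LocalRing L v)) *
              (y.map (algebraMap L (AdeleRing (𝓞 L) L))).map (UnitaryGroup.adeleToLocal L v) * (t.val : Matrix (Fin 3) (Fin 3) (UnitaryGroup.LocalRing L v))) ∧
        (∃ t : GL (Fin 3) (NumberField.mixedEmbedding.mixedSpace L),
          t * Matrix.GeneralLinearGroup.map ((InfiniteAdeleRing.ringEquiv_mixedSpace L).toRingHom.comp (UnitaryGroup.adeleFst L))
                (((UnitaryGroup.cmDatum L 3 H).toAdelic γ₀).val : GL (Fin 3) (AdeleRing (𝓞 L) L)) =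
            Matrix.GeneralLinearGroup.map ((InfiniteAdeleRing.ringEquiv_mixedSpace L).toRingHom.comp (UnitaryGroup.adeleFst L))
                (((UnitaryGroup.cmDatum L 3 H).toAdelic γ₀).val : GL (Fin 3) (AdeleRing (𝓞 L) L)) * t ∧
          ((H.map (algebraMap L (AdeleRing (𝓞 L) L)))⁻¹ * twistGram (adeleConj L) (H.map (algebraMap L (AdeleRing (𝓞 L) L))) (g : Matrix (Fin 3) (Fin 3) (AdeleRing (𝓞 L) L))).map
              ((InfiniteAdeleRing.ringEquiv_mixedSpace L).toRingHom.comp (UnitaryGroup.adeleFst L)) =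
            hermStar (UnitaryGroup.conjMixed (↥(maximalRealSubfield L)) L (IsCMField.complexConj L))
                ((H.map (algebraMap L (AdeleRing (𝓞 L) L))).map ((InfiniteAdeleRing.ringEquiv_mixedSpace L).toRingHom.comp (UnitaryGroup.adeleFst L)))
                (t.val : Matrix (Fin 3) (Fin 3) (NumberField.mixedEmbedding.mixedSpace L)) *
              (y.map (algebraMap L (AdeleRing (𝓞 L) L))).map ((InfiniteAdeleRing.ringEquiv_mixedSpace L).toRingHom.comp (UnitaryGroup.adeleFst L)) *
              (t.val : Matrix (Fin 3) (Fin 3) (NumberField.mixedEmbedding.mixedSpace L)))) :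
    ∀ p : MatchingAdeleG₂ L H H γ₀, p.singularObs hab hγ₀ = 0 ↔ ∃ γ : (UnitaryGroup.cmDatum L 3 H).Rational, p.IsRationalOver γ :=
  fun p => MatchingAdeleG₂.obsHasse_of_placewise hH hHd (fun q : MatchingAdeleG₂ L H H γ₀ => q.singularObs hab hγ₀)
    (fun q => MatchingAdeleG₂.exists_gl_conj_eq_adele_of_mul_sub_eq_zero hab hγ₀ q) (MatchingAdeleG₂.hglue_of_anisotropic hH hHd hanis)
    (fun q g y t hg hy hys hyu ht hx => MatchingAdeleG₂.singularObs_eq_zero_of_adelicCartan_eq (Ne.isUnit hHd) hab ha hb hγ₀ q g y t hg hy hys hyu ht hx)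
    hreal (MatchingAdeleG₂.isConj_toLocal_of_placewise_cartan_eq hHd) (MatchingAdeleG₂.isConj_arch_of_placewise_cartan_eq hHd) p

end Closer

end Literature.NumberTheory.Rogawski1990

end
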